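import Literature.Probability.LatticeModels.GKSInequalities
import Literature.Probability.LatticeModels.SharpnessProofs
import HarnessLib

/-!
# Route SynchronousCoupling · crux `UniformRegularity` (stmt-CriticalPhenomena-4658) ·
# line `Sketch` (magnetic ruler) · stub 1 `stub_fieldMonotone`

The LOWER half of the field sandwich of the magnetic-ruler line: switching on a uniform field
`h ≥ 0` at `β = β_c` can only increase the pair correlation of the plus state on `ℤ³`,
`g(x) = ⟨σ₀σ_x⟩⁺_{β_c,0} ≤ ⟨σ₀σ_x⟩⁺_{β_c,h} = S_h(x)` for `x ≠ 0` (GKS II / monotonicity of the plus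
state in the field). It is the instance `β = β' = β_c`, `0 ≤ h` of the tree's
`Literature.Probability.LatticeModels.plusCorr_mono_params`, after rewriting the critical two-point
function as the plus correlation of the pair observable `{0, x}` at zero field
(`criticalTwoPoint d x = twoPointPlus d (criticalBeta d) x` by `rfl`, `twoPointPlus_eq_plusCorr`).
-/

noncomputable section

open Literature.Probability.LatticeModels

namespace Summit.CriticalPhenomena.Ising3DConformalLimit.Theorems.MagneticRuler

/-- **Stub 1 of line `Sketch` (magnetic ruler, crux stmt-CriticalPhenomena-4658)**: GKS II in the
field for the plus state at `β_c` on `ℤ³` — for `h ≥ 0` and `x ≠ 0`,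
`⟨σ₀σ_x⟩⁺_{β_c,0} ≤ ⟨σ₀σ_x⟩⁺_{β_c,h}` (`plusCorr_mono_params` with `β = β' = β_c ≥ 0`, field `0 ≤ h`,
observable `{0, x}`; `twoPointPlus_eq_plusCorr`). [cite: FriedliVelenik2017, Lemma 3.31, p. 119] -/
theorem stub_fieldMonotone :
    ∀ h : ℝ, 0 ≤ h → ∀ x : Literature.Probability.LatticeModels.Site 3, x ≠ 0 →
      Literature.Probability.LatticeModels.criticalTwoPoint 3 x ≤
        Literature.Probability.LatticeModels.plusCorr 3 (Literature.Probability.LatticeModels.criticalBeta 3) h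
          {0, x} := by
  intro h hh x hx
  have hrw : criticalTwoPoint 3 x = plusCorr 3 (criticalBeta 3) 0 {0, x} :=
    twoPointPlus_eq_plusCorr (criticalBeta 3) hx
  rw [hrw]
  exact plusCorr_mono_params (criticalBeta_nonneg 3) le_rfl le_rfl hh {0, x}

end Summit.CriticalPhenomena.Ising3DConformalLimit.Theorems.MagneticRuler

end
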